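import Summits.Langlands.Langlands.Theses.SkinnerWilesDefectOne
import Summits.Langlands.Langlands.Theorems.SkinnerWilesDefectOneFiveIsogenyEllipticCurvesSatake
import Summits.Langlands.Langlands.Theorems.SkinnerWilesDefectOneFiveIsogenyEllipticCurvesIntegralFrame
import Summits.Langlands.Langlands.Theorems.SkinnerWilesDefectOneFiveIsogenyEllipticCurvesInertiaElement
import Summits.Langlands.Langlands.Theorems.SkinnerWilesDefectOneFiveIsogenyEllipticCurvesGoodOrdinaryModel
import Summits.Langlands.Langlands.Theorems.SkinnerWilesDefectOneFiveIsogenyEllipticCurvesReceptacle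
import Summits.Langlands.Langlands.Theorems.SkinnerWilesDefectOneFiveIsogenyEllipticCurvesOrdinaryVector
import Summits.Langlands.Langlands.Theorems.SkinnerWilesDefectOneFiveIsogenyEllipticCurvesLocalClause
import Summits.Langlands.Langlands.Theorems.SkinnerWilesDefectOneFiveIsogenyEllipticCurvesFrames
import Literature.NumberTheory.Automorphic.ReciprocityGLnPotentialModularityTateProofs
import Literature.NumberTheory.GaloisRepresentations.InertiaRootsOfUnity
import Literature.FieldTheory.AlgClosed.PadicAlgClEquivComplex
import HarnessLib

/-!
# `FiveIsogenyEllipticCurves`: the headline corollary of `ReducibleOrdinaryModular`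
(route `SkinnerWilesDefectOne`, item stmt-Langlands-12922)

`ReducibleOrdinaryModular` (Skinner–Wiles' Theorem A transposed to an imaginary quadratic field)
implies: for `F` imaginary quadratic and `E/𝓞 F` with `Δ ≠ 0`, no geometric CM, an `F`-rational
`5`-isogeny of uniform type above `5` and good ordinary reduction at every `v ∣ 5`, there is an
L-algebraic cuspidal `π` on `GL₂(𝔸_F)` with `Σ α⁻¹ = a_w(E)`, `∏ α⁻¹ = N w` at almost all `w`.
The proof applies `X` to `ρ = V₅(E_F)` framed in the étale frame `(e₀, e₁)` (inertia above `5` fixes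
`P`) resp. the multiplicative frame `(e₁, e₀/5)` (inertia trivial on `E[5]/⟨P⟩`) of a `ℤ₅`-basis of
`T₅ E` adapted to `P` (`…AdaptedBasis`, `…Frames`); `ρ₀` is its integral model (`…IntegralFrame`).
At each `v ∣ 5` (`exists_localData`): the prime `𝔓₀ ∣ v` cut out by the completion, an inertia
element `τ₀` with `ω(τ₀) ≠ 1` (`…InertiaElement`, `e ≤ 2 < 4`), the good ordinary model `E ⊗ 𝒪_v`
(`…GoodOrdinaryModel`), the receptacles `E[5ᵐ] ∩ E₁` (`…Receptacle`), and Serre's ordinary vector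
(`…OrdinaryLine`, `…OrdinaryVector`) give the oriented ordinary frame and `5`-distinguishedness
(`…LocalClause`) and, at one `v ∣ 5`, absolute irreducibility (`…Irreducible`, Serre IV.2.1).
Frobenius characteristic polynomials `X² - a_w X + N w` on `V₅ E` (the tree's Silverman C.21.3)
and `…Satake` turn `SatakeFrobCompatibleAt` into the stated trace/norm identities.

References: C. Skinner, A. Wiles, Publ. Math. IHÉS 89 (1999), Thm A; J.-P. Serre (1968),
IV.2.1, IV A.2.2; A. Caraiani, J. Newton, arXiv:2301.10509, Thm 1.1 (the omitted population).
-/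

noncomputable section

-- `Summit.Langlands.Langlands.…`: summit = sub-problem name (D-0017 layout), as in every Theorems file here.
set_option linter.dupNamespace false

open scoped NumberField MatrixGroups Matrix Classical Polynomial
open Field IsDedekindDomain NumberField Filter Polynomial
open Literature.NumberTheory.EllipticCurves Literature.NumberTheory.GaloisRepresentations
open Literature.NumberTheory.Automorphic Literature.AlgebraicGeometry.Motives WeierstrassCurve
open Summit.Langlands.Langlands.Theses.SkinnerWilesDefectOne

namespace Summit.Langlands.Langlands.Theorems.FiveIsogenyEllipticCurves

/-- `5` is prime (used as a local instance for `ℤ_[5]`, `ℚ_[5]`, `PadicAlgCl 5`). [folklore] -/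
theorem fact_prime_five : Fact (Nat.Prime 5) := ⟨by norm_num⟩

attribute [local instance] fact_prime_five

/-! ### Small lemmas -/

section Small

variable {F : Type} [Field F] [NumberField F]

/-- Every rational prime lies below some finite place of a number field. [folklore] -/
theorem exists_place_natCast_mem {p : ℕ} (hp : p.Prime) :
    ∃ v : HeightOneSpectrum (𝓞 F), ((p : ℕ) : 𝓞 F) ∈ v.asIdeal := by
  have hp' : Prime (p : ℤ) := Nat.prime_iff_prime_int.mp hp
  haveI : (Ideal.span {(p : ℤ)}).IsPrime := (Ideal.span_singleton_prime hp'.ne_zero).mpr hp'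
  have hinj : Function.Injective (algebraMap ℤ (𝓞 F)) := (algebraMap ℤ (𝓞 F)).injective_int
  obtain ⟨Q, -, hQ, hQp⟩ := Ideal.exists_ideal_over_prime_of_isIntegral
    (S := 𝓞 F) (Ideal.span {(p : ℤ)}) ⊥
    (by
      rw [← RingHom.ker_eq_comap_bot, (RingHom.injective_iff_ker_eq_bot _).mp hinj]
      exact bot_le)
  have hmem : (p : ℤ) ∈ Q.comap (algebraMap ℤ (𝓞 F)) := by
    rw [hQp]
    exact Ideal.mem_span_singleton_self _
  refine ⟨⟨Q, hQ, fun hQbot ↦ hp'.ne_zero ?_⟩, ?_⟩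
  · rw [hQbot] at hmem
    exact hinj (by simpa using hmem)
  · simpa using hmem

/-- Cofinitely many places do not contain a given non-zero integer. [folklore] -/
theorem eventually_not_mem {r : 𝓞 F} (hr : r ≠ 0) :
    ∀ᶠ v : HeightOneSpectrum (𝓞 F) in cofinite, r ∉ v.asIdeal := by
  have hne : Ideal.span {r} ≠ ⊥ := by rwa [Ne, Ideal.span_singleton_eq_bot]
  refine Filter.mem_of_superset (Ideal.finite_factors hne).compl_mem_cofinite ?_
  intro v hv hmem
  exact hv (Ideal.dvd_span_singleton.2 hmem)

/-- Valuation in `ℚ̄_ℓ` of an element of `ℚ_ℓ`: `v x < 1 ↔ ‖x‖ < 1`. [folklore] -/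
theorem v_algebraMap_lt_one_iff {ℓ : ℕ} [Fact ℓ.Prime] (x : ℚ_[ℓ]) :
    Valued.v (algebraMap ℚ_[ℓ] (PadicAlgCl ℓ) x) < 1 ↔ ‖x‖ < 1 := by
  rw [PadicAlgCl.valuation_def, ← PadicAlgCl.coe_eq]
  change ‖((x : ℚ_[ℓ]) : PadicAlgCl ℓ)‖₊ < 1 ↔ _
  rw [← NNReal.coe_lt_coe, coe_nnnorm, PadicAlgCl.norm_extends]
  rfl

end Small

/-! ### Local data at a place above `5` -/

section LocalData

variable {F : Type} [Field F] [NumberField F] (E : WeierstrassCurve (𝓞 F)) [(E.baseChange F).IsElliptic]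

/-- **Everything the route's hypotheses need at a place `v ∣ 5`**, for `F` imaginary quadratic and an
integral model `E` with good ordinary reduction at `v` (`Δ(E mod v) ≠ 0`, `5 ∤ a_v`): a prime
`𝔓 ∣ v` with `res(I_{F_v}) ⊆ I_𝔓` (`…LocalClause.exists_prime_inertia_eq`), a local inertia element
`τ` with `χ₅(res τ) ≢ 1 (mod 5)` (`…InertiaElement`), `det T₅(res τ) = χ₅(res τ)`, and Serre's
ordinary vector `f₀` with its eigenvector / trivial-quotient properties (`…OrdinaryVector`, fed by
`…GoodOrdinaryModel`, `…Receptacle` and the tree's `not_surjective_rationalGaloisRepTate_sub_one`),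
together with a fixed vector `v₁` of `res τ`. [cite: SerreAbelianLadic1968, IV A.2.2] -/
theorem exists_localData (hdeg : Module.finrank ℚ F = 2) (v : HeightOneSpectrum (𝓞 F))
    (h5v : ((5 : ℕ) : 𝓞 F) ∈ v.asIdeal) (hΔv : (E.map (Ideal.Quotient.mk v.asIdeal)).Δ ≠ 0)
    (hav : ¬ ((5 : ℕ) : ℤ) ∣ frobTraceAt E v) :
    ∃ (𝔓 : Ideal (absIntegers (𝓞 F) F)) (τ : absoluteGaloisGroup (v.adicCompletion F))
      (f₀ v₁ : (E.baseChange F).rationalTateModule 5),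
      𝔓 ∈ v.primesAbove ∧ τ ∈ absInertia (v.adicCompletion F) ∧
      (∀ σ ∈ absInertia (v.adicCompletion F),
        absGaloisRestrict F (v.adicCompletion F) σ ∈ 𝔓.inertia (absoluteGaloisGroup F)) ∧
      ¬ ((5 : ℕ) : ℤ_[5]) ∣ ((GaloisRep.cyclotomicCharacter F 5
        (absGaloisRestrict F (v.adicCompletion F) τ) : ℤ_[5]ˣ) : ℤ_[5]) - 1 ∧
      LinearMap.det ((E.baseChange F).galoisRepTate 5 (absGaloisRestrict F (v.adicCompletion F) τ)) =
        ((GaloisRep.cyclotomicCharacter F 5 (absGaloisRestrict F (v.adicCompletion F) τ) : ℤ_[5]ˣ) :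
          ℤ_[5]) ∧
      f₀ ≠ 0 ∧ v₁ ≠ 0 ∧
      (E.baseChange F).rationalGaloisRepTate 5 (absGaloisRestrict F (v.adicCompletion F) τ) f₀ =
        ((((GaloisRep.cyclotomicCharacter F 5 (absGaloisRestrict F (v.adicCompletion F) τ) : ℤ_[5]ˣ) :
          ℤ_[5]) : ℚ_[5])) • f₀ ∧
      (E.baseChange F).rationalGaloisRepTate 5 (absGaloisRestrict F (v.adicCompletion F) τ) v₁ = v₁ ∧
      ((E.baseChange F).rationalGaloisRepTate 5 (absGaloisRestrict F (v.adicCompletion F) τ) - 1) *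
        ((E.baseChange F).rationalGaloisRepTate 5 (absGaloisRestrict F (v.adicCompletion F) τ) -
          ((((GaloisRep.cyclotomicCharacter F 5 (absGaloisRestrict F (v.adicCompletion F) τ) :
            ℤ_[5]ˣ) : ℤ_[5]) : ℚ_[5])) • 1) = 0 ∧
      (∀ σ : absoluteGaloisGroup (v.adicCompletion F), ∃ θ : ℚ_[5],
        (E.baseChange F).rationalGaloisRepTate 5 (absGaloisRestrict F (v.adicCompletion F) σ) f₀ = θ • f₀) ∧
      ∀ σ ∈ absInertia (v.adicCompletion F), ∀ y, ∃ c : ℚ_[5],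
        (E.baseChange F).rationalGaloisRepTate 5 (absGaloisRestrict F (v.adicCompletion F) σ) y - y =
          c • f₀ := by
  set W := E.baseChange F with hW
  set res := absGaloisRestrict F (v.adicCompletion F) with hres
  have h5F : ((5 : ℕ) : F) ≠ 0 := by norm_num
  have h52 : (5 : ℕ) ≠ 2 := by norm_num
  -- the prime `𝔓₀` and the inertia element
  obtain ⟨𝔓, h𝔓v, hinto, honto⟩ := exists_prime_inertia_eq F v
  obtain ⟨τ₀', hτ₀'I, hχ⟩ := exists_mem_inertia_cyclotomicCharacter_five_not_dvd hdeg h5v h𝔓v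
  obtain ⟨τ, hτ, hττ₀⟩ := honto τ₀' hτ₀'I
  have hτ₀I : res τ ∈ 𝔓.inertia (absoluteGaloisGroup F) := by rw [hres, hττ₀]; exact hτ₀'I
  have hχ' : ¬ ((5 : ℕ) : ℤ_[5]) ∣ ((GaloisRep.cyclotomicCharacter F 5 (res τ) : ℤ_[5]ˣ) : ℤ_[5]) - 1 := by
    rw [hres, hττ₀]; exact hχ
  -- the good ordinary model `E ⊗ 𝒪_v`
  set M := E.map (algebraMap (𝓞 F) (v.adicCompletionIntegers F)) with hM
  have hCM : (1 : VariableChange (v.adicCompletion F)) • W.baseChange (v.adicCompletion F) =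
      M.map (algebraMap (v.adicCompletionIntegers F) (v.adicCompletion F)) := by
    rw [one_smul, hW, hM]
    simp only [WeierstrassCurve.baseChange, WeierstrassCurve.map_map]
    exact congrArg E.map (RingHom.ext fun r => rfl)
  have hΔ : IsUnit M.Δ := isUnit_Δ_map_adicCompletionIntegers E v hΔv
  have hA : IsUnit (M.hasseCoeff 5) := isUnit_hasseCoeff_map_adicCompletionIntegers E v h52 h5v hΔv hav
  -- receptacles and the one-element bound
  have hX : ∀ m : ℕ, ∃ X : AddSubgroup (geomPoints W), X ≤ geomTorsion W ((5 ^ m : ℕ) : ℤ) ∧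
      Nat.card X ≤ 5 ^ m ∧ ∀ σ ∈ 𝔓.inertia (absoluteGaloisGroup F),
        ∀ P ∈ geomTorsion W ((5 ^ m : ℕ) : ℤ), σ • P - P ∈ X :=
    fun m => exists_receptacle W h52 h5v hCM hΔ hA h𝔓v m
  have hcard := fun m => W.card_map_smul_sub_geomTorsion_le_pow h52 h5v hCM hΔ hA h𝔓v hτ₀I m
  have hns := not_surjective_rationalGaloisRepTate_sub_one W 5 h5F (res τ) hcard
  -- determinants
  set u₀ : ℤ_[5] := ((GaloisRep.cyclotomicCharacter F 5 (res τ) : ℤ_[5]ˣ) : ℤ_[5]) with hu₀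
  haveI := W.module_free_tateModule_holds 5
  haveI := W.module_finite_tateModule_holds 5
  have hdetT : LinearMap.det (W.galoisRepTate 5 (res τ)) = u₀ := by
    have h1 := det_rationalGaloisRepTate_eq_cyclotomicCharacter W 5 (res τ)
    have h2 := LinearMap.det_baseChange (A := ℚ_[5]) (W.galoisRepTate 5 (res τ))
    have hinj : Function.Injective (algebraMap ℤ_[5] ℚ_[5]) := fun x y hxy => by exact_mod_cast hxy
    apply hinj
    rw [← h2]
    exact h1
  -- the ordinary vector
  obtain ⟨f₀, v₁, hf₀, hv₁, hρf₀, hρv₁, hCV, hquotI, hnorm⟩ :=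
    exists_ordinaryVector W 5 h5F hX hτ₀I hdetT hχ' hns
  refine ⟨𝔓, τ, f₀, v₁, h𝔓v, hτ, hinto, hχ', hdetT, hf₀, hv₁, hρf₀, hρv₁, hCV, fun σ => ?_,
    fun σ hσ y => hquotI (res σ) (hinto σ hσ) y⟩
  -- the decomposition group normalises the local inertia group
  refine hnorm (res σ) ?_
  have hconj : σ * τ * σ⁻¹ ∈ absInertia (v.adicCompletion F) :=
    (inferInstance : (absInertia (v.adicCompletion F)).Normal).conj_mem τ hτ σ
  have := hinto _ hconj
  rwa [map_mul, map_mul, map_inv] at this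

end LocalData

/-! ### The corollary from a frame -/

section Main

variable {F : Type} [Field F] [NumberField F]

/-- **`X` applied to `V₅ E` in an integral frame.**  Given `ReducibleOrdinaryModular`, an imaginary
quadratic `F`, an integral model `E` (`Δ ≠ 0`, no geometric CM, good ordinary at every `v ∣ 5`) and
a `ℚ₅`-basis `b` of `V₅ E` whose Galois matrices are integral with lower-left entries `≡ 0`, and
such that every inertia element `σ` above `5` with `det T₅(σ) ≢ 1` has frame entries `σ₀₀ ≡ 1`,
`σ₀₀ ≢ σ₁₁ (mod 5)`: the conclusion of `FiveIsogenyEllipticCurves` holds for `E`.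
[cite: SkinnerWiles1999, §4.5 Theorem A] -/
theorem main_of_frame (hRX : ReducibleOrdinaryModular) (hF : IsTotallyComplex F)
    (hdeg : Module.finrank ℚ F = 2) (E : WeierstrassCurve (𝓞 F)) (hΔ : E.Δ ≠ 0)
    [(E.baseChange F).IsElliptic] (hCM : ¬ (E.baseChange F).HasCM)
    (hord : ∀ v : HeightOneSpectrum (𝓞 F), (5 : 𝓞 F) ∈ v.asIdeal →
      (E.map (Ideal.Quotient.mk v.asIdeal)).Δ ≠ 0 ∧ ¬ ((5 : ℤ) ∣ frobTraceAt E v))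
    (b : Module.Basis (Fin 2) ℚ_[5] ((E.baseChange F).rationalTateModule 5))
    (hb : ∀ (σ : absoluteGaloisGroup F) (i j : Fin 2),
      ‖LinearMap.toMatrix b b ((E.baseChange F).rationalGaloisRepTate 5 σ) i j‖ ≤ 1)
    (hlow : ∀ σ : absoluteGaloisGroup F,
      ‖LinearMap.toMatrix b b ((E.baseChange F).rationalGaloisRepTate 5 σ) 1 0‖ < 1)
    (hres : ∀ σ : absoluteGaloisGroup F,
      (∃ (v : HeightOneSpectrum (𝓞 F)) (𝔓 : Ideal (absIntegers (𝓞 F) F)),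
        ((5 : ℕ) : 𝓞 F) ∈ v.asIdeal ∧ 𝔓 ∈ v.primesAbove ∧ σ ∈ 𝔓.inertia (absoluteGaloisGroup F)) →
      ¬ ((5 : ℕ) : ℤ_[5]) ∣ LinearMap.det ((E.baseChange F).galoisRepTate 5 σ) - 1 →
      ‖LinearMap.toMatrix b b ((E.baseChange F).rationalGaloisRepTate 5 σ) 0 0 - 1‖ < 1 ∧
        ¬ ‖LinearMap.toMatrix b b ((E.baseChange F).rationalGaloisRepTate 5 σ) 0 0 -
          LinearMap.toMatrix b b ((E.baseChange F).rationalGaloisRepTate 5 σ) 1 1‖ < 1) :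
    ∃ (hcpt : isCompact_glFiniteIntegralLevel 2 F) (π : CuspidalAutomorphicRepData 2 F hcpt),
      π.1.IsLAlgebraic ∧ ∀ᶠ w in cofinite, ∃ α : Multiset ℂ, π.1.HasSatakeParamAt w α ∧
        (α.map fun a => a⁻¹).sum = (frobTraceAt E w : ℂ) ∧
        (α.map fun a => a⁻¹).prod = (w.residueCard : ℂ) := by
  have h5F : ((5 : ℕ) : F) ≠ 0 := by norm_num
  have hcpt := isCompact_glFiniteIntegralLevel_holds 2 F
  obtain ⟨ι⟩ := PadicAlgCl.nonempty_ringEquiv_complex 5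
  set ρ := (E.baseChange F).framedTateGaloisRepOfBasis 5 ((E.baseChange F).continuous_rationalGaloisRepTate_holds 5) b with hρ
  -- the integral model
  obtain ⟨ρ₀, hmod⟩ := exists_hasUpperTriangularIntegralModel_framedTate (E.baseChange F) 5
    (O := (Valued.v : Valuation (PadicAlgCl 5) NNReal).valuationSubring) rfl hb
    (fun σ i j hij => by
      have : i = 1 ∧ j = 0 := by revert hij; revert i j; decide
      obtain ⟨rfl, rfl⟩ := this
      exact hlow σ)
  -- unramified almost everywhere
  have h5cof : ∀ᶠ v : HeightOneSpectrum (𝓞 F) in cofinite, ((5 : ℕ) : 𝓞 F) ∉ v.asIdeal :=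
    eventually_not_mem (by exact_mod_cast (show (5 : ℕ) ≠ 0 by norm_num))
  have hunr : ∀ᶠ v in cofinite, ρ.IsUnramifiedAt v := by
    filter_upwards [(E.baseChange F).eventually_hasGoodReductionAt, h5cof] with v hv hv5
    exact ((E.baseChange F).isUnramifiedAt_framedTateGaloisRepOfBasis_iff 5 _ b v).2
      ((E.baseChange F).isUnramifiedAt_rationalTateGaloisRepOf_geomPoints 5 _ hv hv5)
  -- irreducibility, from the local data at one place above `5`
  obtain ⟨v₅, hv₅⟩ := exists_place_natCast_mem (F := F) (Nat.prime_five)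
  have hirr : ρ.toGaloisRep.IsIrreducible := by
    obtain ⟨hΔv, hav⟩ := hord v₅ hv₅
    obtain ⟨𝔓, τ, f₀, v₁, -, -, -, hχ, -, hf₀, hv₁, hρf₀, hρv₁, hCV, -, -⟩ :=
      exists_localData E hdeg v₅ hv₅ hΔv (by exact_mod_cast hav)
    refine isIrreducible_toGaloisRep_framedTate (E.baseChange F) 5 hCM b (fun h => hχ ?_) hCV hv₁ hf₀ hρv₁ hρf₀
    have h' : ((GaloisRep.cyclotomicCharacter F 5 (absGaloisRestrict F (v₅.adicCompletion F) τ) :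
        ℤ_[5]ˣ) : ℤ_[5]) = 1 := Subtype.ext (h.trans PadicInt.coe_one.symm)
    rw [h', sub_self]; exact dvd_zero _
  -- the local clause at every `v ∣ 5`
  have hloc : ∀ v : HeightOneSpectrum (𝓞 F), ((5 : ℕ) : 𝓞 F) ∈ v.asIdeal →
      IsPDistinguishedAt ρ₀ v ∧
      ∃ Q : Matrix.GeneralLinearGroup (Fin 2) (PadicAlgCl 5),
        Valued.v (Q.val 0 0) ≤ Valued.v (Q.val 1 0) ∧
        ∀ σ, (Q⁻¹ * ρ.toLocal v σ * Q).val 1 0 = 0 ∧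
          (σ ∈ absInertia (v.adicCompletion F) →
            (Q⁻¹ * ρ.toLocal v σ * Q).val 1 1 ^ 1 = 1 ∧
            (Q⁻¹ * ρ.toLocal v σ * Q).val 0 0 ^ 1 =
              algebraMap (Padic 5) (PadicAlgCl 5)
                (((GaloisRep.cyclotomicCharacter (v.adicCompletion F) 5 σ).val : PadicInt 5) :
                  Padic 5) ^ ((2 - 1) * 1)) := by
    intro v hv
    obtain ⟨hΔv, hav⟩ := hord v hv
    obtain ⟨𝔓, τ, f₀, v₁, h𝔓v, hτ, hinto, hχ, hdetT, hf₀, -, -, -, -, hstab, hquot⟩ :=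
      exists_localData E hdeg v hv hΔv (by exact_mod_cast hav)
    have hdet' : ¬ ((5 : ℕ) : ℤ_[5]) ∣ LinearMap.det ((E.baseChange F).galoisRepTate 5
        (absGaloisRestrict F (v.adicCompletion F) τ)) - 1 := by rwa [hdetT]
    obtain ⟨h00, hdist⟩ := hres _ ⟨v, 𝔓, hv, h𝔓v, hinto τ hτ⟩ hdet'
    refine localClause (E.baseChange F) 5 rfl v h5F b hmod hf₀ hstab hquot hτ ?_ ?_
    · rw [framedTateGaloisRepOfBasis_entry, ← map_one (algebraMap ℚ_[5] (PadicAlgCl 5)), ← map_sub,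
        v_algebraMap_lt_one_iff]
      exact h00
    · rw [framedTateGaloisRepOfBasis_entry, framedTateGaloisRepOfBasis_entry, ← map_sub,
        v_algebraMap_lt_one_iff]
      exact hdist
  -- apply `X`
  obtain ⟨π, hLalg, hSat⟩ := hRX F hF hdeg 5 (by norm_num) _ rfl hcpt ι ρ ρ₀ hirr hunr hmod
    ⟨2, le_rfl, 1, one_pos, fun v hv => hloc v hv⟩
  refine ⟨hcpt, π, hLalg, ?_⟩
  -- Frobenius characteristic polynomials of `V₅ E` and the Satake identities
  haveI := (E.baseChange F).module_finite_rationalTateModule_holds 5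
  have hΔcof : ∀ᶠ w : HeightOneSpectrum (𝓞 F) in cofinite, E.Δ ∉ w.asIdeal := eventually_not_mem hΔ
  filter_upwards [hSat, hΔcof, h5cof] with w hw hΔw h5w
  have hgood : (E.baseChange F).HasGoodReductionAt w := hasGoodReductionAt_baseChange_of_Δ_not_mem hΔw
  have hP := (E.baseChange F).hasFrobCharpolyAt_rationalTateGaloisRepOf_of_hasGoodReductionAt
    ((E.baseChange F).trace_galoisRepTate_frobenius_of_hasGoodReductionAt_holds 5)
    ((E.baseChange F).det_galoisRepTate_frobenius_of_hasGoodReductionAt_holds 5)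
    ((E.baseChange F).continuous_rationalGaloisRepTate_holds 5) h5w hgood
  have hP' := ((E.baseChange F).hasFrobCharpolyAt_framedTateGaloisRepOfBasis_iff 5 _ b w _).2 hP
  rw [frobeniusTraceAt_baseChange_eq_frobTraceAt hΔw, natCard_residueField_eq_residueCard] at hP'
  have hP'' : ρ.HasFrobCharpolyAt w
      (X ^ 2 - C ((frobTraceAt E w : ℤ) : PadicAlgCl 5) * X + C ((w.residueCard : ℕ) : PadicAlgCl 5)) := by
    have e : (X ^ 2 - C (frobTraceAt E w : ℚ_[5]) * X + C (w.residueCard : ℚ_[5])).map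
        (algebraMap ℚ_[5] (PadicAlgCl 5)) =
        X ^ 2 - C ((frobTraceAt E w : ℤ) : PadicAlgCl 5) * X + C ((w.residueCard : ℕ) : PadicAlgCl 5) := by
      simp [Polynomial.map_sub, Polynomial.map_add, Polynomial.map_mul, Polynomial.map_pow]
    rw [← e]
    exact hP'
  exact exists_hasSatakeParamAt_sum_prod_of_satakeFrobCompatibleAt hw hP''

omit [NumberField F] in
/-- Membership of a `5`-torsion point in `E[5]` (`geomTorsion`). [folklore] -/
theorem mem_geomTorsion_five {W : WeierstrassCurve F} {P : geomPoints W} (hP : (5 : ℕ) • P = 0) :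
    P ∈ geomTorsion W ((5 : ℕ) : ℤ) :=
  (Submodule.mem_torsionBy_iff _ _).mpr (by rw [natCast_zsmul]; exact hP)

/-- **`FiveIsogenyEllipticCurves`** (item stmt-Langlands-12922): the headline corollary of the
route's target `ReducibleOrdinaryModular`, proved by the étale frame when inertia above `5` fixes
the generator `P` of the isogeny kernel and by the multiplicative frame when it acts trivially on
`E[5]/⟨P⟩` (`main_of_frame`, `…Frames`). [cite: SkinnerWiles1999, §4.5 Theorem A] -/
theorem fiveIsogenyEllipticCurves_proof : FiveIsogenyEllipticCurves := by
  intro hRX F _ _ hF hdeg E hΔ hCM hP hord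
  obtain ⟨P, hP0, hP5, hPstab, hType⟩ := hP
  set W := E.baseChange F with hW
  haveI : W.IsElliptic := by
    rw [WeierstrassCurve.isElliptic_iff, hW, WeierstrassCurve.baseChange, WeierstrassCurve.map_Δ]
    exact (isUnit_iff_ne_zero.mpr
      ((map_ne_zero_iff _ (FaithfulSMul.algebraMap_injective (𝓞 F) F)).mpr hΔ))
  have h5F : ((5 : ℕ) : F) ≠ 0 := by norm_num
  obtain ⟨e, he⟩ := exists_basis_proj_one_eq W 5 h5F (mem_geomTorsion_five hP5) hP0
  rcases hType with hEt | hMult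
  · -- étale type: the frame `(e₀, e₁)`
    refine main_of_frame hRX hF hdeg E hΔ hCM hord (Algebra.TensorProduct.basis ℚ_[5] e)
      (norm_toMatrix_etaleBasis_le_one W 5 e) (fun σ => ?_) (fun σ hσ hdet => ?_)
    · obtain ⟨a, ha⟩ := hPstab σ
      exact norm_toMatrix_etaleBasis_one_zero_lt_one W 5 e he ha
    · obtain ⟨v, 𝔓, hv, h𝔓, hσI⟩ := hσ
      exact residual_etaleBasis W 5 e he (hEt v hv 𝔓 h𝔓 σ hσI) hdet
  · -- multiplicative type: the frame `(e₁, e₀/5)`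
    refine main_of_frame hRX hF hdeg E hΔ hCM hord
      (((Algebra.TensorProduct.basis ℚ_[5] e).unitsSMul ![(isUnit_inv_natCast 5).unit, 1]).reindex
        (Equiv.swap 0 1))
      (fun σ => (norm_toMatrix_multBasis W 5 e he hPstab σ).1)
      (fun σ => (norm_toMatrix_multBasis W 5 e he hPstab σ).2) (fun σ hσ hdet => ?_)
    obtain ⟨v, 𝔓, hv, h𝔓, hσI⟩ := hσ
    obtain ⟨a₀, ha₀⟩ := hPstab σ
    have h1 : (5 : ℕ) • TateModule.proj 5 1 (e 1) = 0 := by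
      have := TateModule.pow_smul_proj 1 (e 1)
      rwa [pow_one] at this
    obtain ⟨a₁, ha₁⟩ := hMult v hv 𝔓 h𝔓 σ hσI (TateModule.proj 5 1 (e 1)) h1
    exact residual_multBasis W 5 e he ha₀ ha₁ hdet

end Main

end Summit.Langlands.Langlands.Theorems.FiveIsogenyEllipticCurves

end
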